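import Mathlib
import Summits.Ventures.PercRepro2.TypedBases

/-!
# Two-copy typed bases as statements about exchangeable couplings of two copies
(blind cell PercRepro2, typer-1 g15, 2026-08-26)

The cell's two-copy typed bases (`TypedBases.lean`, mine-1: rows 2′TBHK, 2′W) say that every
weight-free typed sum `typedSum Φ n` of a two-copy function `Φ` — the sum of `Φ ω₁ ω₂` over the
pairs with edge-count vector `typeVec ω₁ ω₂ = n` — is nonnegative; `twoCopy_nonneg_of_typed_nonneg`
then gives the weighted two-copy sum `∑ weight p ω₁ · weight p ω₂ · Φ ω₁ ω₂ ≥ 0` for every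
admissible `p`.  This file is the two-copy version of `TriExchangeable.lean`:

* an **edge-wise exchangeable coupling** of two copies is a product over the edges of laws
  `l e : Bool → Bool → R` that are nonnegative and symmetric (`IsSymmetric`);
  `pairExpect l Φ = ∑_{x,y} (∏_e l e (x e) (y e)) Φ x y` is the expectation of `Φ` under it; the
  i.i.d. coupling `iid₂ p` gives the weighted two-copy sum (`pairExpect_iid₂`);
* every symmetric edge law is a mixture of the three **typed laws** `nu₂ k` (uniform on the pairs
  with exactly `k` open copies; `symmetric_eq_sum_nu₂`), the expectation expands over the type
  vectors `τ : E → Fin 3` (`pairExpect_eq_sum_types`), and the expectation under `nu₂ ∘ τ` is a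
  nonnegative multiple of `typedSum Φ τ` (`pairExpect_nu₂_eq_typedSum`);
* **`typedSum_nonneg_iff_symmetric`** : `(∀ n, 0 ≤ typedSum Φ n) ↔`
  `∀ l, (∀ e a b, 0 ≤ l e a b) → (∀ e, IsSymmetric (l e)) → 0 ≤ pairExpect l Φ` — a two-copy
  typed base is nonnegative iff `Φ` has nonnegative expectation under EVERY edge-wise exchangeable
  coupling of two copies (`twoCopy_nonneg_of_symmetric` re-derives the weighted statement).

Own work; standard axioms.
-/

namespace Summit.Ventures.PercRepro2

namespace PairExchange

/-! ## Edge laws -/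

section Laws

variable {R : Type*} [Field R] [LinearOrder R] [IsStrictOrderedRing R]

/-- The number of open copies among the two states `a b` of an edge (`= typeVec x y e`). -/
def cnt₂ (a b : Bool) : ℕ := a.toNat + b.toNat

/-- `cnt₂` is at most `2`. -/
lemma cnt₂_le_two (a b : Bool) : cnt₂ a b ≤ 2 := by
  cases a <;> cases b <;> decide

/-- `cnt₂` is symmetric. -/
lemma cnt₂_swap (a b : Bool) : cnt₂ a b = cnt₂ b a := by
  unfold cnt₂; omega

/-- `cnt₂` as an element of `Fin 3`. -/
def cntFin₂ (a b : Bool) : Fin 3 := ⟨cnt₂ a b, Nat.lt_succ_of_le (cnt₂_le_two a b)⟩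

/-- An edge law of two copies is **symmetric** (exchangeable) when swapping the copies leaves it
unchanged. -/
def IsSymmetric (l : Bool → Bool → R) : Prop := ∀ a b, l a b = l b a

/-- The value of a symmetric law on the orbit with `k` open copies. -/
def cval₂ (l : Bool → Bool → R) : ℕ → R
  | 0 => l false false
  | 1 => l true false
  | _ => l true true

omit [Field R] [LinearOrder R] [IsStrictOrderedRing R] in
/-- A symmetric law depends only on the number of open copies. -/
lemma symmetric_eq_cval₂ {l : Bool → Bool → R} (hl : IsSymmetric l) (a b : Bool) :
    l a b = cval₂ l (cnt₂ a b) := by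
  cases a <;> cases b
  · rfl
  · exact hl false true
  · rfl
  · rfl

omit [IsStrictOrderedRing R] in
/-- The orbit values of a nonnegative law are nonnegative. -/
lemma cval₂_nonneg {l : Bool → Bool → R} (hl : ∀ a b, 0 ≤ l a b) (n : ℕ) : 0 ≤ cval₂ l n := by
  rcases n with _ | _ | n
  · exact hl _ _
  · exact hl _ _
  · show 0 ≤ l true true
    exact hl _ _

/-- The **typed law of type `k`**: the uniform law on the pairs with exactly `k` open copies. -/
def nu₂ (k : ℕ) (a b : Bool) : R := if cnt₂ a b = k then 1 / (Nat.choose 2 k : R) else 0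

/-- The typed laws are nonnegative. -/
lemma nu₂_nonneg (k : ℕ) (a b : Bool) : 0 ≤ nu₂ (R := R) k a b := by
  unfold nu₂
  split_ifs
  · positivity
  · exact le_rfl

omit [LinearOrder R] [IsStrictOrderedRing R] in
/-- The typed laws are symmetric. -/
lemma nu₂_isSymmetric (k : ℕ) : IsSymmetric (nu₂ (R := R) k) := by
  intro a b
  unfold nu₂
  rw [cnt₂_swap a b]

omit [LinearOrder R] [IsStrictOrderedRing R] in
/-- The typed law of type `k : Fin 3`, as a point mass at the orbit `cntFin₂`. -/
lemma nu₂_eq (k : Fin 3) (a b : Bool) :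
    nu₂ (R := R) k a b = if k = cntFin₂ a b then 1 / (Nat.choose 2 (k : ℕ) : R) else 0 := by
  unfold nu₂
  have h : (k = cntFin₂ a b) ↔ (cnt₂ a b = k) := by
    rw [Fin.ext_iff, eq_comm]
    exact Iff.rfl
  simp only [h]

/-- The mixture coefficients of a symmetric law: `c k = C(2, k) · l(orbit k)`. -/
def coef₂ (l : Bool → Bool → R) (k : Fin 3) : R := (Nat.choose 2 (k : ℕ) : R) * cval₂ l k

/-- The mixture coefficients of a nonnegative law are nonnegative. -/
lemma coef₂_nonneg {l : Bool → Bool → R} (hl : ∀ a b, 0 ≤ l a b) (k : Fin 3) : 0 ≤ coef₂ l k :=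
  mul_nonneg (by positivity) (cval₂_nonneg hl _)

/-- **Every symmetric edge law is a mixture of the three typed laws**:
`l a b = ∑ k, coef₂ l k · nu₂ k a b`. -/
lemma symmetric_eq_sum_nu₂ {l : Bool → Bool → R} (hl : IsSymmetric l) (a b : Bool) :
    l a b = ∑ k : Fin 3, coef₂ l k * nu₂ k a b := by
  rw [symmetric_eq_cval₂ hl]
  simp_rw [nu₂_eq]
  simp only [mul_ite, mul_zero, Finset.sum_ite_eq', Finset.mem_univ, if_true]
  have hc : (Nat.choose 2 (cnt₂ a b) : R) ≠ 0 := by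
    exact_mod_cast (Nat.choose_pos (cnt₂_le_two a b)).ne'
  show cval₂ l (cnt₂ a b) =
    (Nat.choose 2 (cnt₂ a b) : R) * cval₂ l (cnt₂ a b) * (1 / (Nat.choose 2 (cnt₂ a b) : R))
  field_simp

end Laws

/-! ## Product couplings and their expectations -/

section Expect

variable {R : Type*} [Field R] [LinearOrder R] [IsStrictOrderedRing R]
  {E : Type*} [Fintype E] [DecidableEq E]

/-- The expectation of a two-copy function under the edge-wise product coupling with laws `l e`. -/
def pairExpect (l : E → Bool → Bool → R) (Φ : Config E → Config E → R) : R :=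
  ∑ x : Config E, ∑ y : Config E, (∏ e, l e (x e) (y e)) * Φ x y

omit [LinearOrder R] [IsStrictOrderedRing R] in
/-- Moving the innermost of three sums outermost. -/
lemma sum_comm3 {α β γ : Type*} [Fintype α] [Fintype β] [Fintype γ] (F : α → β → γ → R) :
    (∑ x : α, ∑ y : β, ∑ i : γ, F x y i) = ∑ i : γ, ∑ x : α, ∑ y : β, F x y i := by
  have h1 : ∀ x : α, (∑ y : β, ∑ i : γ, F x y i) = ∑ i : γ, ∑ y : β, F x y i :=
    fun x => Finset.sum_comm
  simp only [h1]
  exact Finset.sum_comm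

/-- The edge-wise product of symmetric laws expands over the type vectors `τ : E → Fin 3`. -/
lemma prod_symmetric_eq_sum (l : E → Bool → Bool → R) (hl : ∀ e, IsSymmetric (l e))
    (x y : Config E) :
    (∏ e, l e (x e) (y e)) =
      ∑ τ : E → Fin 3, (∏ e, coef₂ (l e) (τ e)) * ∏ e, nu₂ (τ e) (x e) (y e) := by
  calc (∏ e, l e (x e) (y e))
      = ∏ e, ∑ k : Fin 3, coef₂ (l e) k * nu₂ k (x e) (y e) :=
        Finset.prod_congr rfl fun e _ => symmetric_eq_sum_nu₂ (hl e) _ _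
    _ = ∑ τ : E → Fin 3, ∏ e, coef₂ (l e) (τ e) * nu₂ (τ e) (x e) (y e) :=
        Fintype.prod_sum _
    _ = _ := by simp_rw [Finset.prod_mul_distrib]

/-- **Multilinearity**: the expectation under symmetric edge laws is the mixture, over the type
vectors `τ : E → Fin 3`, of the expectations under the typed laws `nu₂ (τ e)`. -/
theorem pairExpect_eq_sum_types (l : E → Bool → Bool → R) (hl : ∀ e, IsSymmetric (l e))
    (Φ : Config E → Config E → R) :
    pairExpect l Φ =
      ∑ τ : E → Fin 3, (∏ e, coef₂ (l e) (τ e)) * pairExpect (fun e => nu₂ (τ e)) Φ := by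
  unfold pairExpect
  simp_rw [prod_symmetric_eq_sum l hl, Finset.sum_mul, Finset.mul_sum, mul_assoc]
  exact sum_comm3 _

/-! ## Typed laws and typed sums -/

omit [LinearOrder R] [IsStrictOrderedRing R] [DecidableEq E] in
/-- The product of the typed laws is a point mass on the pairs with edge-count vector `τ`. -/
lemma prod_nu₂_eq (τ : E → ℕ) (x y : Config E) :
    (∏ e, nu₂ (τ e) (x e) (y e) : R) =
      if typeVec x y = τ then ∏ e, (1 / (Nat.choose 2 (τ e) : R)) else 0 := by
  unfold nu₂
  rw [Fintype.prod_ite_zero]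
  have h : (∀ e, cnt₂ (x e) (y e) = τ e) ↔ typeVec x y = τ := funext_iff.symm
  simp only [h]

omit [LinearOrder R] [IsStrictOrderedRing R] in
/-- The typed sum as a double sum with an indicator. -/
lemma typedSum_eq (Φ : Config E → Config E → R) (n : E → ℕ) :
    typedSum Φ n = ∑ x : Config E, ∑ y : Config E, if typeVec x y = n then Φ x y else 0 := by
  unfold typedSum
  rw [Finset.sum_filter, Fintype.sum_prod_type]

omit [LinearOrder R] [IsStrictOrderedRing R] in
/-- **Typed expectations are typed sums**: under the typed laws `nu₂ (τ e)` the expectation of `Φ`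
is `∏ e, C(2, τ e)⁻¹` times the typed sum `typedSum Φ τ`. -/
theorem pairExpect_nu₂_eq_typedSum (τ : E → ℕ) (Φ : Config E → Config E → R) :
    pairExpect (fun e => nu₂ (τ e)) Φ = (∏ e, (1 / (Nat.choose 2 (τ e) : R))) * typedSum Φ τ := by
  rw [typedSum_eq]
  unfold pairExpect
  simp_rw [Finset.mul_sum]
  refine Finset.sum_congr rfl fun x _ => Finset.sum_congr rfl fun y _ => ?_
  rw [prod_nu₂_eq]
  split_ifs <;> ring

omit [DecidableEq E] in
/-- The normalising constant of the typed laws is nonnegative. -/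
lemma prod_inv_choose₂_nonneg (τ : E → ℕ) : 0 ≤ ∏ e, (1 / (Nat.choose 2 (τ e) : R)) :=
  Finset.prod_nonneg fun e _ => by positivity

omit [DecidableEq E] in
/-- The normalising constant of the typed laws is positive when `τ ≤ 2`. -/
lemma prod_inv_choose₂_pos (τ : E → ℕ) (hτ : ∀ e, τ e ≤ 2) :
    0 < ∏ e, (1 / (Nat.choose 2 (τ e) : R)) :=
  Finset.prod_pos fun e _ => one_div_pos.mpr (by exact_mod_cast Nat.choose_pos (hτ e))

omit [LinearOrder R] [IsStrictOrderedRing R] in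
/-- A typed sum at an edge count above `2` is empty. -/
lemma typedSum_eq_zero_of_two_lt (Φ : Config E → Config E → R) {n : E → ℕ} {e : E}
    (he : 2 < n e) : typedSum Φ n = 0 := by
  unfold typedSum
  refine Finset.sum_eq_zero fun x hx => ?_
  have hn : typeVec x.1 x.2 = n := (Finset.mem_filter.mp hx).2
  have h2 : typeVec x.1 x.2 e ≤ 2 := cnt₂_le_two (x.1 e) (x.2 e)
  rw [hn] at h2
  omega

/-! ## The i.i.d. coupling -/

/-- The i.i.d. edge laws of the weight vector `p`: `p_e ⊗ p_e`. -/
def iid₂ (p : E → R) (e : E) (a b : Bool) : R := edgeFactor (p e) a * edgeFactor (p e) b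

omit [LinearOrder R] [IsStrictOrderedRing R] [Fintype E] [DecidableEq E] in
/-- The i.i.d. laws are symmetric. -/
lemma iid₂_isSymmetric (p : E → R) (e : E) : IsSymmetric (iid₂ p e) := by
  intro a b
  unfold iid₂
  ring

omit [Fintype E] [DecidableEq E] in
/-- The i.i.d. laws of an admissible weight vector are nonnegative. -/
lemma iid₂_nonneg (p : E → R) (hp : ∀ e, 0 ≤ p e ∧ p e ≤ 1) (e : E) (a b : Bool) :
    0 ≤ iid₂ p e a b := by
  have h : ∀ d : Bool, 0 ≤ edgeFactor (p e) d := by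
    intro d
    cases d
    · exact sub_nonneg.mpr (hp e).2
    · exact (hp e).1
  exact mul_nonneg (h a) (h b)

omit [LinearOrder R] [IsStrictOrderedRing R] in
/-- **The i.i.d. coupling gives the weighted two-copy sum.** -/
theorem pairExpect_iid₂ (p : E → R) (Φ : Config E → Config E → R) :
    pairExpect (iid₂ p) Φ = ∑ ω₁ : Config E, ∑ ω₂ : Config E, weight p ω₁ * weight p ω₂ * Φ ω₁ ω₂ := by
  unfold pairExpect iid₂ weight
  simp_rw [Finset.prod_mul_distrib]

/-! ## The typed bases -/

/-- **Two-copy typed bases are the exchangeable-coupling inequality**: every typed sum of `Φ` is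
nonnegative iff `Φ` has nonnegative expectation under every edge-wise product coupling of two copies
with nonnegative symmetric edge laws. -/
theorem typedSum_nonneg_iff_symmetric (Φ : Config E → Config E → R) :
    (∀ n : E → ℕ, 0 ≤ typedSum Φ n) ↔
      ∀ l : E → Bool → Bool → R, (∀ e a b, 0 ≤ l e a b) → (∀ e, IsSymmetric (l e)) →
        0 ≤ pairExpect l Φ := by
  constructor
  · intro h l hl0 hl
    rw [pairExpect_eq_sum_types l hl]
    refine Finset.sum_nonneg fun τ _ =>
      mul_nonneg (Finset.prod_nonneg fun e _ => coef₂_nonneg (hl0 e) _) ?_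
    rw [pairExpect_nu₂_eq_typedSum (fun e => (τ e : ℕ))]
    exact mul_nonneg (prod_inv_choose₂_nonneg _) (h _)
  · intro h n
    by_cases hn : ∀ e, n e ≤ 2
    · have key := h (fun e => nu₂ (n e)) (fun e a b => nu₂_nonneg _ _ _) (fun e => nu₂_isSymmetric _)
      rw [pairExpect_nu₂_eq_typedSum, mul_nonneg_iff_of_pos_left (prod_inv_choose₂_pos n hn)] at key
      exact key
    · obtain ⟨e, he⟩ : ∃ e, 2 < n e := by
        by_contra hcon
        exact hn fun e => not_lt.mp fun h => hcon ⟨e, h⟩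
      rw [typedSum_eq_zero_of_two_lt Φ he]

/-- **The weighted two-copy sum from the exchangeable-coupling inequality** (the i.i.d. coupling is
one exchangeable coupling; re-derives `twoCopy_nonneg_of_typed_nonneg`). -/
theorem twoCopy_nonneg_of_symmetric (Φ : Config E → Config E → R)
    (h : ∀ l : E → Bool → Bool → R, (∀ e a b, 0 ≤ l e a b) → (∀ e, IsSymmetric (l e)) →
      0 ≤ pairExpect l Φ)
    {p : E → R} (hp : IsProbVec p) :
    0 ≤ ∑ ω₁ : Config E, ∑ ω₂ : Config E, weight p ω₁ * weight p ω₂ * Φ ω₁ ω₂ := by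
  rw [← pairExpect_iid₂]
  exact h (iid₂ p) (iid₂_nonneg p fun e => ⟨hp.nonneg e, hp.le_one e⟩) (iid₂_isSymmetric p)

end Expect

end PairExchange

end Summit.Ventures.PercRepro2
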